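import Literature.AnabelianGeometry.EtaleTheta.Discharge.Sec3ConstantLineToyGenuine
import HarnessLib

/-!
# [EtTh] Cor. 3.8 proof, row C38-L05: the pre-step criterion holds OUTRIGHT at the tree's genuine-vocabulary
# tempered Frobenioid (positive companion of the `ℤ_{≥0}³` countermodel; proof-only)

S. Mochizuki, *The étale theta function …*, Publ. RIMS **45** (2009) [EtTh], proof of Cor. 3.8, PDF p.81 l.20–27
("a pre-step is base-field-theoretic iff its image in `C^pf` is a [filtered] projective limit of pre-steps
abstractly equivalent to an endomorphism in `O^▷(−)`") [cite: MochizukiEtTh2009, Cor 3.8 p.81]; Def. 3.6 (ii), p.77.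

abc-iut cell, layer L2 (seat abc-iut-w5-d164 gen 3; rows NV-L2/Cor38Hyp + Example39Data).  abc-iut-w5-d124's
`bsFldPreStepLimitCriterion_of` (p422576) proves row C38-L05 modulo {`hF`, `hP34Λ`, `hNZ`, `hSup`}; their
`Cor38Toy` (p425444, an `ℤ_{≥0}³` toy over the all-`True` vocabularies) shows the row is NOT derivable from the
typed interface alone; abc-iut-w4-d008's `Sec3ConstantLineToyGenuine` (p429700) runs the `hNZ` chain end-to-end at
abc-iut-w5-d164's `Toy.genuineTemperedFrobenioid` (p427934: genuine [FrdI] vocabularies, constructed realification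
`ℕ^rlf`, Frobenioid certificate) leaving `hSup` as the only binder.  THIS FILE removes it there: at that datum
`Φ^{bs-fld} = Φ` (`Toy.of_mem_cnstR_of_mem_pfImage`: every divisor maps into `ℝ·Φ₀^cnst`), so EVERY divisor is
base-field-theoretic, every element of `Φ^pf` lies in `(Φ^{bs-fld})^pf`, and the supremum property `hSup` holds with
`y := m`.  Hence **`Toy.bsFldPreStepLimitCriterion_genuine`: row C38-L05 with NO binder** at a constructed,
Frobenioid-certified tempered Frobenioid over the genuine vocabularies — the typed criterion is CONSISTENT with the
whole interface stack (complementing the negative `Cor38Toy`).  HONEST LABEL: degenerate geometry (one object, one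
prime, `Λ = ℤ`, all functions constant); a consistency witness only; nothing here bears on [IUTchIII] Cor. 3.12.
-/

noncomputable section

namespace Literature.AnabelianGeometry.EtaleTheta

open CategoryTheory Opposite Literature.AlgebraicGeometry.Frobenioids

namespace Toy

variable (R S : ((Discrete PUnit.{1})ᵒᵖ ⥤ CommMonCat.{0}) → Prop)

/-- At the genuine toy every divisor is base-field-theoretic (`Φ^{bs-fld} = Φ`: the image of `ℕ^pf` lies in
`ℝ·Φ₀^cnst`, `Toy.of_mem_cnstR_of_mem_pfImage`). [cite: MochizukiEtTh2009, Def 3.6 p.77] -/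
theorem isBaseFieldTheoreticDiv_genuine (A : (Discrete PUnit.{1})ᵒᵖ)
    (x : (genuineTemperedFrobenioid R S).Φ.carrier A) :
    (genuineTemperedFrobenioid R S).IsBaseFieldTheoreticDiv x :=
  (TemperedFrobenioid.isBaseFieldTheoreticDiv_iff x).mpr (of_mem_cnstR_of_mem_pfImage _ x.2)

/-- Hence every element of `Φ(W)^pf` lies in `(Φ^{bs-fld})^pf(W)` at the genuine toy. [cite: MochizukiEtTh2009, Cor 3.8 p.81] -/
theorem mem_bsFldPf_genuine (W : Discrete PUnit.{1})
    (m : Perfection ((genuineTemperedFrobenioid R S).divisorMonoid.obj (op W))) :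
    m ∈ (genuineTemperedFrobenioid R S).bsFldPf W := by
  obtain ⟨⟨l, N⟩, rfl⟩ := Perfection.mk_surjective m
  exact ⟨l, N, isBaseFieldTheoreticDiv_genuine R S (op W) l, rfl⟩

/-- The supremum property `hSup` of abc-iut-w5-d124's criterion HOLDS at the genuine toy, with `y := m`.
[cite: MochizukiEtTh2009, Cor 3.8 p.81] -/
theorem hSup_genuine (W : Discrete PUnit.{1})
    (m : Perfection ((genuineTemperedFrobenioid R S).divisorMonoid.obj (op W)))
    (U : Set (Perfection ((genuineTemperedFrobenioid R S).divisorMonoid.obj (op W))))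
    (_hU : U ⊆ (genuineTemperedFrobenioid R S).bsFldPf W) (_hne : U.Nonempty) (hdvd : ∀ u ∈ U, u ∣ m) :
    ∃ y ∈ (genuineTemperedFrobenioid R S).bsFldPf W, (∀ u ∈ U, u ∣ y) ∧ y ∣ m :=
  ⟨m, mem_bsFldPf_genuine R S W m, hdvd, dvd_rfl⟩

/-- **Row C38-L05 (`BsFldPreStepLimitCriterion`) holds with NO binder at the tree's genuine-vocabulary tempered
Frobenioid** `Toy.genuineTemperedFrobenioid R S` (for THE perfection of [FrdI] attached to its Frobenioid
certificate): abc-iut-w4-d008's `bsFldPreStepLimitCriterion_genuineTemperedFrobenioid` (`Prop34 ✓`, `hcyc ✓`) with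
`hSup` discharged by `hSup_genuine`. [cite: MochizukiEtTh2009, Cor 3.8 p.81] -/
theorem bsFldPreStepLimitCriterion_genuine :
    (genuineTemperedFrobenioid R S).BsFldPreStepLimitCriterion
      (PreFrobenioidData.perfection (isFrobenioid_genuineTemperedFrobenioid R S)) :=
  bsFldPreStepLimitCriterion_genuineTemperedFrobenioid R S (hSup_genuine R S)

end Toy

end Literature.AnabelianGeometry.EtaleTheta

end
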